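/-
Copyright (c) 2026. All rights reserved.
Released under Apache 2.0 license as described in the file LICENSE.
Authors: abc-iut cell, prover seat abc-iut-w4-d095 (wave 4), adapting the reductions of abc-iut-w5-d097
(`LogFrobeniusLogWallOfObstruction.lean`, `LogFrobeniusLogWallPlusOfObstruction.lean`) over the statements of
abc-iut-L4-t3 (`LogFrobeniusObservables.lean`).
-/
import Literature.AnabelianGeometry.AbsoluteAnabelian.LogFrobeniusLogWallArchOrigin
import Mathlib.CategoryTheory.Types.Basic
import HarnessLib

/-!
# [AbsTopIII] Corollary 5.5 (iv), first sentence (print-faithful `Cor55LogWall`): the ARCHIMEDEAN cycle on the `TS` side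

S. Mochizuki, *Topics in absolute anabelian geometry III: global reconstruction algorithms*, J. Math. Sci. Univ.
Tokyo 22 (2015) 939–1156 [MochizukiAbsTopIII2015]; locators = pages of the author's manuscript
(`paper:url-5493eb38cbb7`): Cor 5.5 (iv) p. 131 and its proof pp. 132–133; Cor 5.5 (iii) p. 131 l. 30–32 (`ι⊞_{v,ε}` for
`ε` an edge of `Γ⃗^⋉_v`, `ι_{v,ε}` for `ε` an edge of `Γ⃗^log_v`); Def 5.4 (v) p. 127 (the archimedean graph
`k~ →(id) k~ ↠ k^× ↪ k`; `Γ⃗^⋉_arc` omits `↪ k`; "the entire diagram `Γ⃗^log_arc` may be considered as a diagram in the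
category TH, whereas the diagram `Γ⃗^⋉_arc` may be considered either … in TH or … in TH⊞"); proof of Cor 4.5 (iv) p. 110.

PROOF-ONLY companion.  The archimedean cycle `k~ →(id) k~ ↠(exp) k^× ↪ k` of the printed proof runs through the
space-link arrow `k^× ↪ k`, which in print carries only the `TS`-valued homotopy `ι_{v,ε}` of the observable `S_log`
(referee lane finding L12-n1 of abc-iut-ref-l: the cell's `⊞`-interface also indexes `ι⊞` by that arrow — a CELL-SIDE
WIDENING).  abc-iut-w5-d097's archimedean reduction (`cor55Incompatibility_of_archObstruction`) goes through the
`⊞`-pins; here is the same cycle argument run on the `TS` side, i.e. using ONLY the pins of `S_log` (print's `ι_{v,ε}`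
on the three arrows of `Γ⃗^log_arc`) and the core homotopy — so that the conclusion is the print-faithful
`Cor55LogWall T` and the route survives a re-typing of the `⊞`-edges to `Γ⃗^⋉_arc`:

* `cor55LogWall_of_cycleObstructionTS` / `cor55LogWall_of_archObstructionTS` — the `TS` twin of abc-iut-w5-d097's
  `cor55Incompatibility_of_cycleObstruction` / `…_of_archObstruction`, proved by the chain of homotopies of their
  `cor55LogWall_of_twoPathObstruction` closed up into a CYCLE: `[id₁]·[λ_sl] ~(core) [log]·[id₀]·[λ_sl] ~(ι_{ε₁})
  [id₁]·[λ_{ν₂}] ~(ι_{ε₂}) [id₁]·[λ_{νₘ}] ~(ι_{ε₃}) [id₁]·[λ_sl]`, whose homotopy must be the identity (Def 3.5 (ii):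
  `ζ_{(γ,γ)} = id`); "writing out explicitly the meaning of such an equality" at `x₀` gives
  `λ_sl(α) ≫ ι_{ε₁} ≫ ι_{ε₂} ≫ ι_{ε₃} = 𝟙` — excluded by the obstruction.
* `cor55LogWall_of_iotaTS_spaceLink_not_surjective` — the set-theoretic sufficient condition (a set-valued functor on
  `𝒩_{v₀}` under which the `TS`-arrow into the space-link vertex, print's `k^× ↪ k`, is not surjective).
* `archGenuine_cor55LogWall_TS` — at the setting with genuine archimedean components and ITS `TS`-datum
  (`LogFrobeniusLogWallArchOrigin.lean`) the hypothesis is met (`k^× ↪ k` misses `0`): a second, print-faithful route to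
  `archGenuine_cor55LogWall` there.

Refereed pre-IUT material; OUR kernel check of typed statements; nothing here bears on [IUTchIII] Cor. 3.12; no side
taken; typed ≠ proved; model-level ≠ node-level.
-/

set_option autoImplicit false

universe w u

open CategoryTheory Quiver

namespace Literature.AnabelianGeometry.AbsoluteAnabelian

namespace LogFrobeniusSetting

variable {Vmod : Type u} {isArc : Vmod → Bool} (L : LogFrobeniusSetting Vmod isArc)

/-- Components of heterogeneously equal natural transformations (between propositionally equal functors) are
heterogeneously equal. [folklore] -/
private theorem app_heq_of_heq_natTrans {C : Type (u + 1)} [Category.{u} C] {D : Type (u + 1)} [Category.{u} D]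
    {F G F' G' : C ⥤ D} {α : F ⟶ G} {β : F' ⟶ G'} (h : HEq α β) (hF : F = F') (hG : G = G') (x : C) :
    HEq (α.app x) (β.app x) := by
  subst hF hG
  cases h
  rfl

/-- Components of a natural transformation at propositionally equal objects are heterogeneously equal. [folklore] -/
private theorem app_heq_app {C : Type (u + 1)} [Category.{u} C] {D : Type (u + 1)} [Category.{u} D]
    {F G : C ⥤ D} (α : F ⟶ G) {x y : C} (h : x = y) : HEq (α.app x) (α.app y) := by
  subst h
  rfl

/-- Images under propositionally equal functors of heterogeneously equal morphisms. [folklore] -/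
private theorem map_heq_map {C : Type (u + 1)} [Category.{u} C] {D : Type (u + 1)} [Category.{u} D]
    {F G : C ⥤ D} (hFG : F = G) {a b a' b' : C} (ha : a = a') (hb : b = b') {f : a ⟶ b} {g : a' ⟶ b'}
    (h : HEq f g) : HEq (F.map f) (G.map g) := by
  subst hFG ha hb
  cases h
  rfl

/-- A four-term cycle identity transported along heterogeneous equalities of its terms. [folklore] -/
private theorem eq_id_of_heq_cycle {C : Type (u + 1)} [Category.{u} C] {o₀ o₁ o₂ o₃ c₀ c₁ c₂ c₃ : C}
    (h₀ : o₀ = c₀) (h₁ : o₁ = c₁) (h₂ : o₂ = c₂) (h₃ : o₃ = c₃)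
    {κ₁ : o₀ ⟶ o₁} {κ₂ : o₁ ⟶ o₂} {κ₃ : o₂ ⟶ o₃} {κ₄ : o₃ ⟶ o₀}
    {n₁ : c₀ ⟶ c₁} {n₂ : c₁ ⟶ c₂} {n₃ : c₂ ⟶ c₃} {n₄ : c₃ ⟶ c₀}
    (e₁ : HEq κ₁ n₁) (e₂ : HEq κ₂ n₂) (e₃ : HEq κ₃ n₃) (e₄ : HEq κ₄ n₄)
    (key : ((κ₁ ≫ κ₂) ≫ κ₃) ≫ κ₄ = 𝟙 _) : n₁ ≫ n₂ ≫ n₃ ≫ n₄ = 𝟙 _ := by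
  subst h₀ h₁ h₂ h₃
  cases e₁; cases e₂; cases e₃; cases e₄
  simpa only [Category.assoc] using key

/-- Components of a homotopy given by the whiskering axiom of Def 3.5 (ii) (b), read heterogeneously. [folklore] -/
private theorem heq_app_of_eq_whisker {C₁ C₂ C₃ C₄ : Type (u + 1)} [Category.{u} C₁] [Category.{u} C₂]
    [Category.{u} C₃] [Category.{u} C₄] {F : C₁ ⥤ C₂} {P Q : C₂ ⥤ C₃} {G : C₃ ⥤ C₄} {A B : C₁ ⥤ C₄}
    (η : P ⟶ Q) {θ : A ⟶ B} {E : A = F ⋙ (P ⋙ G)} {E' : F ⋙ (Q ⋙ G) = B}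
    (W : θ = eqToHom E ≫ Functor.whiskerLeft F (Functor.whiskerRight η G) ≫ eqToHom E') (x : C₁) :
    HEq (θ.app x) (G.map (η.app (F.obj x))) := by
  subst E E' W
  rw [eqToHom_refl, eqToHom_refl, Category.id_comp, Category.comp_id]
  rfl

/-- Transport of `IsIso` along a heterogeneous equality of morphisms with propositionally equal endpoints. [folklore] -/
private theorem isIso_of_heq_hom {C : Type*} [Category C] {a b a' b' : C} (ha : a = a') (hb : b = b')
    {f : a ⟶ b} {g : a' ⟶ b'} (h : HEq f g) (hf : IsIso f) : IsIso g := by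
  subst ha hb
  cases h
  exact hf

/-- **[AbsTopIII] Cor 5.5 (iv), first sentence (print-faithful `Cor55LogWall`), REDUCED to a component-level CYCLE
obstruction on the `TS` side at one place** (the Cor 4.5 (iv) / Lemma 4.4 mechanism).  Data: a place `v₀`; pre-log
vertices `ν₂`, `νₘ`; edges `ε₁ : postLog → ν₂`, `ε₂ : ν₂ → νₘ`, `ε₃ : νₘ → spaceLink` of `Γ⃗^log_{v₀}` (at an archimedean
place: `k~ →(id) k~`, `k~ ↠ k^×`, `k^× ↪ k`; ALL carry `TS`-valued `ι_{v₀,ε}`, Def 5.4 (vii)); an object `x₀`.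
Hypothesis (components on `𝒩_{v₀}`, compared by `HEq`): for NO isomorphism `a : x₀ ⥲ log(x₀)` is
`λ_{sl}(a) ≫ ι_{ε₁} ≫ ι_{ε₂} ≫ ι_{ε₃}` the identity.  Conclusion: `L.Cor55LogWall T`.
[cite: MochizukiAbsTopIII2015, Cor 5.5 (iv) p. 131] -/
theorem cor55LogWall_of_cycleObstructionTS (T : L.TSHomotopies) (v₀ : Vmod) (ν₂ νₘ : LogVertex (isArc v₀))
    (h₂ : ν₂.isPostLog = false) (hₘ : νₘ.isPostLog = false)
    (ε₁ : LogEdgeTS (isArc v₀) (LogVertex.postLog (isArc v₀)) ν₂) (ε₂ : LogEdgeTS (isArc v₀) ν₂ νₘ)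
    (ε₃ : LogEdgeTS (isArc v₀) νₘ (LogVertex.spaceLink (isArc v₀))) (x₀ : L.X)
    (obstruction : ∀ (a : x₀ ⟶ L.log.obj x₀), IsIso a →
      ∀ (m₁ : (L.lam v₀ (LogVertex.spaceLink (isArc v₀)) ⋙ L.forget v₀).obj (L.log.obj x₀) ⟶
          (L.lam v₀ ν₂ ⋙ L.forget v₀).obj x₀)
        (m₂ : (L.lam v₀ ν₂ ⋙ L.forget v₀).obj x₀ ⟶ (L.lam v₀ νₘ ⋙ L.forget v₀).obj x₀)
        (m₃ : (L.lam v₀ νₘ ⋙ L.forget v₀).obj x₀ ⟶ (L.lam v₀ (LogVertex.spaceLink (isArc v₀)) ⋙ L.forget v₀).obj x₀),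
        HEq m₁ ((T.iota v₀ ε₁).app x₀) → HEq m₂ ((T.iota v₀ ε₂).app x₀) → HEq m₃ ((T.iota v₀ ε₃).app x₀) →
          (L.lam v₀ (LogVertex.spaceLink (isArc v₀)) ⋙ L.forget v₀).map a ≫ m₁ ≫ m₂ ≫ m₃ ≠ 𝟙 _) :
    L.Cor55LogWall T := by
  rintro ⟨Hc, hHc, K, Hplus, Hts, hcore, hcK, hobsAll⟩
  obtain ⟨-, ⟨-, hpre, hpost⟩, htsK⟩ := hobsAll v₀
  have hsl : (LogVertex.spaceLink (isArc v₀)).isPostLog = false := spaceLink_isPostLog _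
  have hpl : (LogVertex.postLog (isArc v₀)).isPostLog = true := by
    generalize isArc v₀ = b; cases b <;> rfl
  /- (1) the core homotopy `ζ₀` for `([id_1], [id_0]∘[log])`, transported into `K` -/
  let X₁ : ExtShape.{u} (DSub (DVertex.InFirstRows (Vmod := Vmod) (isArc := isArc) 1)) :=
    obsShape (DVertex.InFirstRows 1) DVertex.core
  let a₁ : X₁.Vertex := X₁.base ⟨.row1 (0 + 1), trivial, le_rfl⟩
  let a₀ : X₁.Vertex := X₁.base ⟨.row1 0, trivial, le_rfl⟩
  let tc1 : a₁ ⟶ X₁.obs := DEdge.toCore (0 + 1)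
  let lg : a₁ ⟶ a₀ := DEdge.log 0
  let tc0 : a₀ ⟶ X₁.obs := DEdge.toCore 0
  have hc₀ : Hc.E ((Path.nil : Path a₁ a₁).cons tc1) (((Path.nil : Path a₁ a₁).cons lg).cons tc0) :=
    hcore.boundary_all _ _
  have hiso₀ : IsIso (Hc.η hc₀) :=
    DiagramOfCategories.HomotopyFamily.isIso_of_isSymmetric _ Hc hcore.isSymmetric hc₀
  obtain ⟨k₀, hk₀⟩ := hcK _ _ hc₀
  let v1 : DVertex Vmod isArc := .row1 (0 + 1)
  let pId1 : Path v1 DVertex.core := (Path.nil : Path v1 v1).cons (DEdge.toCore (0 + 1))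
  let pLog : Path v1 DVertex.core := ((Path.nil : Path v1 v1).cons (DEdge.log 0)).cons (DEdge.toCore 0)
  have k₀' : K.E pId1 pLog := k₀
  have hisoK : IsIso (K.η k₀') := by
    refine isIso_of_heq_hom ?_ ?_ hk₀ hiso₀
    · simp only [pId1, DiagramOfCategories.pathFunctor_cons, DiagramOfCategories.pathFunctor_nil]; rfl
    · simp only [pLog, DiagramOfCategories.pathFunctor_cons, DiagramOfCategories.pathFunctor_nil]; rfl
  /- (2) the three `TS`-pins at `v₀`, transported into `K` -/
  obtain ⟨hm₁, hpin₁⟩ := hpost (LogVertex.postLog (isArc v₀)) ν₂ ε₁ hpl h₂ hsl 0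
  obtain ⟨hm₂, hpin₂⟩ := hpre ν₂ νₘ ε₂ h₂ hₘ
  obtain ⟨hm₃, hpin₃⟩ := hpre νₘ (LogVertex.spaceLink (isArc v₀)) ε₃ hₘ hsl
  obtain ⟨t₁, ht₁⟩ := htsK _ _ hm₁
  obtain ⟨t₂, ht₂⟩ := htsK _ _ hm₂
  obtain ⟨t₃, ht₃⟩ := htsK _ _ hm₃
  let lamP : ∀ (ν : LogVertex (isArc v₀)) (hν : ν.isPostLog = false),
      Path (DVertex.core : DVertex Vmod isArc) (DVertex.nv v₀) :=
    fun ν hν => ((Path.nil : Path (DVertex.core : DVertex Vmod isArc) DVertex.core).cons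
      (DEdge.lam v₀ ν hν)).cons (DEdge.forget v₀)
  have t₁' : K.E (pLog.comp (lamP _ hsl)) (pId1.comp (lamP ν₂ h₂)) := t₁
  have t₂' : K.E (lamP ν₂ h₂) (lamP νₘ hₘ) := t₂
  have t₃' : K.E (lamP νₘ hₘ) (lamP _ hsl) := t₃
  /- (3) the cycle `[id₁]·[λ_sl] ~ [log]·[id₀]·[λ_sl] ~ [id₁]·[λ_{ν₂}] ~ [id₁]·[λ_{νₘ}] ~ [id₁]·[λ_sl]` in `K` -/
  have s1 : K.E (pId1.comp (lamP _ hsl)) (pLog.comp (lamP _ hsl)) :=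
    K.isSaturated.precomp (K.isSaturated.postcomp k₀' (lamP _ hsl)) Path.nil
  have s2 : K.E (pId1.comp (lamP ν₂ h₂)) (pId1.comp (lamP νₘ hₘ)) :=
    K.isSaturated.precomp (K.isSaturated.postcomp t₂' Path.nil) pId1
  have s3 : K.E (pId1.comp (lamP νₘ hₘ)) (pId1.comp (lamP _ hsl)) :=
    K.isSaturated.precomp (K.isSaturated.postcomp t₃' Path.nil) pId1
  -- a family assigns the IDENTITY to a pair `(γ, γ)`: the composite around the cycle is `𝟙`
  have key : ((K.η s1 ≫ K.η t₁') ≫ K.η s2) ≫ K.η s3 = 𝟙 _ := by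
    rw [← K.η_trans s1 t₁', ← K.η_trans, ← K.η_trans]
    exact K.η_refl _
  have keyx : (((K.η s1).app x₀ ≫ (K.η t₁').app x₀) ≫ (K.η s2).app x₀) ≫ (K.η s3).app x₀ = 𝟙 _ := by
    have := NatTrans.congr_app key x₀
    simpa only [NatTrans.comp_app, NatTrans.id_app] using this
  /- (4) functor identities along the explicit paths (the path functors are recursive: propositional only) -/
  have E_nil : L.diagram.pathFunctor (Path.nil : Path v1 v1) = 𝟭 L.X := DiagramOfCategories.pathFunctor_nil _ _
  have E_id1 : L.diagram.pathFunctor pId1 = 𝟭 L.X := by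
    simp only [pId1, DiagramOfCategories.pathFunctor_cons, DiagramOfCategories.pathFunctor_nil]; rfl
  have E_log : L.diagram.pathFunctor pLog = L.log := by
    simp only [pLog, DiagramOfCategories.pathFunctor_cons, DiagramOfCategories.pathFunctor_nil]; rfl
  have Q : ∀ (ν : LogVertex (isArc v₀)) (hν : ν.isPostLog = false),
      L.diagram.pathFunctor (lamP ν hν) = L.lam v₀ ν ⋙ L.forget v₀ := by
    intro ν hν
    simp only [lamP, DiagramOfCategories.pathFunctor_cons, DiagramOfCategories.pathFunctor_nil]; rfl
  have E1c : ∀ (ν : LogVertex (isArc v₀)) (hν : ν.isPostLog = false),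
      L.diagram.pathFunctor (pId1.comp (lamP ν hν)) = L.lam v₀ ν ⋙ L.forget v₀ := by
    intro ν hν
    simp only [pId1, lamP, Path.comp_cons, Path.comp_nil, DiagramOfCategories.pathFunctor_cons,
      DiagramOfCategories.pathFunctor_nil]; rfl
  have ELc : ∀ (ν : LogVertex (isArc v₀)) (hν : ν.isPostLog = false),
      L.diagram.pathFunctor (pLog.comp (lamP ν hν)) = L.log ⋙ (L.lam v₀ ν ⋙ L.forget v₀) := by
    intro ν hν
    simp only [pLog, lamP, Path.comp_cons, Path.comp_nil, DiagramOfCategories.pathFunctor_cons,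
      DiagramOfCategories.pathFunctor_nil]; rfl
  have PTS : ∀ (ν : LogVertex (isArc v₀)) (hν : ν.isPostLog = false),
      (L.logDiagramTS v₀).pathFunctor (lamPathTS v₀ ν hν) = L.lam v₀ ν ⋙ L.forget v₀ := by
    intro ν hν
    simp only [lamPathTS, lamEdgeTS, forgetEdgeTS, DiagramOfCategories.pathFunctor_cons,
      DiagramOfCategories.pathFunctor_nil]; rfl
  have PTSd : (L.logDiagramTS v₀).pathFunctor (postLogDomPathTS v₀ 0 hsl) =
      L.log ⋙ (L.lam v₀ (LogVertex.spaceLink (isArc v₀)) ⋙ L.forget v₀) := by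
    simp only [postLogDomPathTS, logEdgeTS, toCoreEdgeTS, lamEdgeTS, forgetEdgeTS,
      DiagramOfCategories.pathFunctor_cons, DiagramOfCategories.pathFunctor_nil]; rfl
  have PTSc : (L.logDiagramTS v₀).pathFunctor (postLogCodPathTS v₀ 0 ν₂ h₂) = L.lam v₀ ν₂ ⋙ L.forget v₀ := by
    simp only [postLogCodPathTS, toCoreEdgeTS, lamEdgeTS, forgetEdgeTS, DiagramOfCategories.pathFunctor_cons,
      DiagramOfCategories.pathFunctor_nil]; rfl
  /- (5) the four factors, heterogeneously: `ζ'₀ = λ_{sl}(ζ₀)`, `ι_{ε₁}` at `x₀`, `ι_{ε₂}`, `ι_{ε₃}` at `x₀` -/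
  have ht₁' : HEq ((Hts v₀).η hm₁) (K.η t₁') := ht₁
  have ht₂' : HEq ((Hts v₀).η hm₂) (K.η t₂') := ht₂
  have ht₃' : HEq ((Hts v₀).η hm₃) (K.η t₃') := ht₃
  have g₁ : HEq ((K.η t₁').app x₀) ((T.iota v₀ ε₁).app x₀) := by
    obtain ⟨o, o', H⟩ := hpin₁ x₀
    exact (app_heq_of_heq_natTrans ht₁' (PTSd.trans (ELc _ hsl).symm) (PTSc.trans (E1c ν₂ h₂).symm) x₀).symm.trans
      ((conj_eqToHom_iff_heq' _ _ o o').mp H)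
  have g₂ : ∀ y : L.X, HEq ((K.η t₂').app y) ((T.iota v₀ ε₂).app y) := fun y => by
    obtain ⟨o, o', H⟩ := hpin₂ y
    exact (app_heq_of_heq_natTrans ht₂' ((PTS ν₂ h₂).trans (Q ν₂ h₂).symm) ((PTS νₘ hₘ).trans (Q νₘ hₘ).symm) y).symm.trans
      ((conj_eqToHom_iff_heq' _ _ o o').mp H)
  have g₃ : ∀ y : L.X, HEq ((K.η t₃').app y) ((T.iota v₀ ε₃).app y) := fun y => by
    obtain ⟨o, o', H⟩ := hpin₃ y
    exact (app_heq_of_heq_natTrans ht₃' ((PTS νₘ hₘ).trans (Q νₘ hₘ).symm) ((PTS _ hsl).trans (Q _ hsl).symm) y).symm.trans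
      ((conj_eqToHom_iff_heq' _ _ o o').mp H)
  -- object identities at `x₀`
  have hx_nil : (L.diagram.pathFunctor (Path.nil : Path v1 v1)).obj x₀ = x₀ := Functor.congr_obj E_nil x₀
  have hx_id1 : (L.diagram.pathFunctor pId1).obj x₀ = x₀ := Functor.congr_obj E_id1 x₀
  have hx_log : (L.diagram.pathFunctor pLog).obj x₀ = L.log.obj x₀ := Functor.congr_obj E_log x₀
  -- the isomorphism `α = ζ₀(x₀) : x₀ ⥲ log(x₀)`
  haveI := hisoK
  obtain ⟨a, ha⟩ : ∃ a : x₀ ⟶ L.log.obj x₀, a = eqToHom hx_id1.symm ≫ (K.η k₀').app x₀ ≫ eqToHom hx_log :=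
    ⟨_, rfl⟩
  have ha_iso : IsIso a :=
    isIso_of_heq_hom hx_id1 hx_log ((conj_eqToHom_iff_heq' _ _ hx_id1.symm hx_log).mp ha).symm inferInstance
  have ha_heq : HEq ((K.η k₀').app ((L.diagram.pathFunctor (Path.nil : Path v1 v1)).obj x₀)) a :=
    (app_heq_app (K.η k₀') hx_nil).trans ((conj_eqToHom_iff_heq' _ _ hx_id1.symm hx_log).mp ha).symm
  have E_nilN : L.diagram.pathFunctor (Path.nil : Path (DVertex.nv v₀ : DVertex Vmod isArc) (DVertex.nv v₀)) = 𝟭 _ :=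
    DiagramOfCategories.pathFunctor_nil _ _
  -- (e1) `ζ'₀` at `x₀` is `λ_{sl}(α)`
  have e1 : HEq ((K.η s1).app x₀) ((L.lam v₀ (LogVertex.spaceLink (isArc v₀)) ⋙ L.forget v₀).map a) :=
    (heq_app_of_eq_whisker (K.η k₀') (K.η_whisker k₀' Path.nil (lamP _ hsl)) x₀).trans
      (map_heq_map (Q _ hsl) ((Functor.congr_obj E_id1 _).trans hx_nil)
        ((Functor.congr_obj E_log _).trans (congrArg L.log.obj hx_nil)) ha_heq)
  -- (e2), (e3) `ι_{ε₂}`, `ι_{ε₃}` at `x₀` (pre-composed with `[id_1]`)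
  have e2 : HEq ((K.η s2).app x₀) ((T.iota v₀ ε₂).app x₀) :=
    (heq_app_of_eq_whisker (K.η t₂') (K.η_whisker t₂' pId1 Path.nil) x₀).trans
      (map_heq_map E_nilN (by rw [Functor.congr_obj (Q ν₂ h₂), hx_id1, h₂]; rfl)
        (by rw [Functor.congr_obj (Q νₘ hₘ), hx_id1]) ((app_heq_app (K.η t₂') hx_id1).trans (g₂ _)))
  have e3 : HEq ((K.η s3).app x₀) ((T.iota v₀ ε₃).app x₀) :=
    (heq_app_of_eq_whisker (K.η t₃') (K.η_whisker t₃' pId1 Path.nil) x₀).trans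
      (map_heq_map E_nilN (by rw [Functor.congr_obj (Q νₘ hₘ), hx_id1, hₘ]; rfl)
        (by rw [Functor.congr_obj (Q _ hsl), hx_id1]) ((app_heq_app (K.η t₃') hx_id1).trans (g₃ _)))
  /- (6) "writing out explicitly the meaning" of `ζ = id` at `x₀` -/
  have h₀ : (L.diagram.pathFunctor (pId1.comp (lamP _ hsl))).obj x₀ =
      (L.lam v₀ (LogVertex.spaceLink (isArc v₀)) ⋙ L.forget v₀).obj x₀ := Functor.congr_obj (E1c _ hsl) x₀
  have h₁ : (L.diagram.pathFunctor (pLog.comp (lamP _ hsl))).obj x₀ =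
      (L.lam v₀ (LogVertex.spaceLink (isArc v₀)) ⋙ L.forget v₀).obj (L.log.obj x₀) :=
    Functor.congr_obj (ELc _ hsl) x₀
  have h₂' : (L.diagram.pathFunctor (pId1.comp (lamP ν₂ h₂))).obj x₀ = (L.lam v₀ ν₂ ⋙ L.forget v₀).obj x₀ :=
    Functor.congr_obj (E1c ν₂ h₂) x₀
  have h₃' : (L.diagram.pathFunctor (pId1.comp (lamP νₘ hₘ))).obj x₀ = (L.lam v₀ νₘ ⋙ L.forget v₀).obj x₀ :=
    Functor.congr_obj (E1c νₘ hₘ) x₀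
  obtain ⟨m₁, hm₁⟩ : ∃ m₁ : (L.lam v₀ (LogVertex.spaceLink (isArc v₀)) ⋙ L.forget v₀).obj (L.log.obj x₀) ⟶
      (L.lam v₀ ν₂ ⋙ L.forget v₀).obj x₀, m₁ = eqToHom h₁.symm ≫ (K.η t₁').app x₀ ≫ eqToHom h₂' := ⟨_, rfl⟩
  obtain ⟨m₂, hm₂⟩ : ∃ m₂ : (L.lam v₀ ν₂ ⋙ L.forget v₀).obj x₀ ⟶ (L.lam v₀ νₘ ⋙ L.forget v₀).obj x₀,
      m₂ = eqToHom h₂'.symm ≫ (K.η s2).app x₀ ≫ eqToHom h₃' := ⟨_, rfl⟩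
  obtain ⟨m₃, hm₃⟩ : ∃ m₃ : (L.lam v₀ νₘ ⋙ L.forget v₀).obj x₀ ⟶
      (L.lam v₀ (LogVertex.spaceLink (isArc v₀)) ⋙ L.forget v₀).obj x₀,
      m₃ = eqToHom h₃'.symm ≫ (K.η s3).app x₀ ≫ eqToHom h₀ := ⟨_, rfl⟩
  have c₁ : HEq ((K.η t₁').app x₀) m₁ := ((conj_eqToHom_iff_heq' _ _ h₁.symm h₂').mp hm₁).symm
  have c₂ : HEq ((K.η s2).app x₀) m₂ := ((conj_eqToHom_iff_heq' _ _ h₂'.symm h₃').mp hm₂).symm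
  have c₃ : HEq ((K.η s3).app x₀) m₃ := ((conj_eqToHom_iff_heq' _ _ h₃'.symm h₀).mp hm₃).symm
  exact obstruction a ha_iso m₁ m₂ m₃ (c₁.symm.trans g₁) (c₂.symm.trans e2) (c₃.symm.trans e3)
    (eq_id_of_heq_cycle h₀ h₁ h₂' h₃' e1 c₁ c₂ c₃ keyx)

/-- At an ARCHIMEDEAN place `Γ⃗^log_arc` (`k~ →(id) k~ ↠ k^× ↪ k`, Def 5.4 (v); all three arrows carry `TS`-valued
`ι_{v,ε}`) contains the cycle required by `cor55LogWall_of_cycleObstructionTS`.  Stated for `b = true`.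
[cite: MochizukiAbsTopIII2015, Def 5.4 (v) p. 127] -/
theorem exists_logCycleTS_of_eq_true (b : Bool) (hb : b = true) :
    ∃ (ν₂ νₘ : LogVertex b) (_ : ν₂.isPostLog = false) (_ : νₘ.isPostLog = false),
      Nonempty (LogEdgeTS b (LogVertex.postLog b) ν₂) ∧ Nonempty (LogEdgeTS b ν₂ νₘ) ∧
        Nonempty (LogEdgeTS b νₘ (LogVertex.spaceLink b)) := by
  subst hb
  exact ⟨ArchVertex.pre, ArchVertex.mult, rfl, rfl, ⟨ArchEdge.postLogId⟩, ⟨ArchEdge.shell⟩,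
    ⟨ArchEdge.multToSpaceLink⟩⟩

/-- **[AbsTopIII] Cor 5.5 (iv), first sentence (`Cor55LogWall`), from the ARCHIMEDEAN cycle obstruction on the `TS`
side** at one archimedean place `v₀` (for every printed cycle and every isomorphism `a : x₀ ⥲ log(x₀)`, the composite
`λ_sl(a) ≫ ι_{ε₁} ≫ ι_{ε₂} ≫ ι_{ε₃}` on `𝒩_{v₀}` is not the identity). [cite: MochizukiAbsTopIII2015, Cor 5.5 (iv) p. 131] -/
theorem cor55LogWall_of_archObstructionTS (T : L.TSHomotopies) (v₀ : Vmod) (hv₀ : isArc v₀ = true) (x₀ : L.X)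
    (obstruction : ∀ (ν₂ νₘ : LogVertex (isArc v₀)) (_ : ν₂.isPostLog = false) (_ : νₘ.isPostLog = false)
      (ε₁ : LogEdgeTS (isArc v₀) (LogVertex.postLog (isArc v₀)) ν₂) (ε₂ : LogEdgeTS (isArc v₀) ν₂ νₘ)
      (ε₃ : LogEdgeTS (isArc v₀) νₘ (LogVertex.spaceLink (isArc v₀))) (a : x₀ ⟶ L.log.obj x₀), IsIso a →
      ∀ (m₁ : (L.lam v₀ (LogVertex.spaceLink (isArc v₀)) ⋙ L.forget v₀).obj (L.log.obj x₀) ⟶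
          (L.lam v₀ ν₂ ⋙ L.forget v₀).obj x₀)
        (m₂ : (L.lam v₀ ν₂ ⋙ L.forget v₀).obj x₀ ⟶ (L.lam v₀ νₘ ⋙ L.forget v₀).obj x₀)
        (m₃ : (L.lam v₀ νₘ ⋙ L.forget v₀).obj x₀ ⟶ (L.lam v₀ (LogVertex.spaceLink (isArc v₀)) ⋙ L.forget v₀).obj x₀),
        HEq m₁ ((T.iota v₀ ε₁).app x₀) → HEq m₂ ((T.iota v₀ ε₂).app x₀) → HEq m₃ ((T.iota v₀ ε₃).app x₀) →
          (L.lam v₀ (LogVertex.spaceLink (isArc v₀)) ⋙ L.forget v₀).map a ≫ m₁ ≫ m₂ ≫ m₃ ≠ 𝟙 _) :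
    L.Cor55LogWall T := by
  obtain ⟨ν₂, νₘ, h₂, hₘ, ⟨ε₁⟩, ⟨ε₂⟩, ⟨ε₃⟩⟩ := exists_logCycleTS_of_eq_true (isArc v₀) hv₀
  exact L.cor55LogWall_of_cycleObstructionTS T v₀ ν₂ νₘ h₂ hₘ ε₁ ε₂ ε₃ x₀ (obstruction ν₂ νₘ h₂ hₘ ε₁ ε₂ ε₃)

/-- **[AbsTopIII] Cor 5.5 (iv), first sentence (`Cor55LogWall`), from the non-surjectivity of print's `k^× ↪ k` read on
the `TS` side**: for any setting, `TS`-datum, archimedean place `v₀`, object `x₀` and set-valued functor `Φ` on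
`𝒩_{v₀}`, if the `x₀`-component of `ι_{v₀,ε}` is not surjective under `Φ` for every edge `ε` of `Γ⃗^log_{v₀}` from a
pre-log vertex into the space-link vertex, then `L.Cor55LogWall T`. [cite: MochizukiAbsTopIII2015, Cor 5.5 (iv) p. 131] -/
theorem cor55LogWall_of_iotaTS_spaceLink_not_surjective (T : L.TSHomotopies) (v₀ : Vmod) (hv₀ : isArc v₀ = true)
    (x₀ : L.X) (Φ : L.N v₀ ⥤ Type w)
    (hΦ : ∀ (ν : LogVertex (isArc v₀)), ν.isPostLog = false →
      ∀ ε : LogEdgeTS (isArc v₀) ν (LogVertex.spaceLink (isArc v₀)),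
        ¬ Function.Surjective (Φ.map ((T.iota v₀ ε).app x₀) : _ → _)) :
    L.Cor55LogWall T := by
  refine L.cor55LogWall_of_archObstructionTS T v₀ hv₀ x₀ ?_
  intro ν₂ νₘ _ hₘ ε₁ ε₂ ε₃ a _ m₁ m₂ m₃ _ _ hm₃ hcomp
  have hobj : (L.lam v₀ νₘ ⋙ L.forget v₀).obj x₀ =
      ((frobeniusTwist L.log νₘ.isPostLog ⋙ L.lam v₀ νₘ) ⋙ L.forget v₀).obj x₀ := by
    rw [hₘ]
    rfl
  have hm₃' : m₃ = eqToHom hobj ≫ (T.iota v₀ ε₃).app x₀ ≫ eqToHom rfl :=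
    (conj_eqToHom_iff_heq' m₃ ((T.iota v₀ ε₃).app x₀) hobj rfl).mpr hm₃
  have hsurj : Function.Surjective (Φ.map m₃ : _ → _) := by
    have h := congrArg Φ.map hcomp
    intro y
    refine ⟨Φ.map m₂ (Φ.map m₁
      (Φ.map ((L.lam v₀ (LogVertex.spaceLink (isArc v₀)) ⋙ L.forget v₀).map a) y)), ?_⟩
    have hy := CategoryTheory.congr_fun h y
    simp only [Functor.map_comp_apply, Functor.map_id_apply] at hy
    exact hy
  rw [hm₃'] at hsurj
  simp only [eqToHom_refl, Category.comp_id, Functor.map_comp, types_comp] at hsurj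
  exact hΦ νₘ hₘ ε₃ (Function.Surjective.of_comp hsurj)

/-- At an archimedean place, the `TS`-valued `ι` of the genuine-archimedean model (`archIotaTS`,
`LogFrobeniusLogWallArchOrigin.lean`) along any edge into the space-link vertex — `k^× ↪ k` — has a non-surjective
underlying map of arithmetic data.  Stated for `b = true`. [cite: MochizukiAbsTopIII2015, Def 5.4 (v) p. 127] -/
theorem forget_archIotaTS_spaceLink_not_surjective (𝔄 : AutHolFieldFunctor.{u}) (b : Bool) (hb : b = true)
    (ν : LogVertex b) (ε : LogEdgeTS b ν (LogVertex.spaceLink b)) (x₀ : Up (HolTFPair 𝔄)) :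
    ¬ Function.Surjective
      ((inducedFunctor _ ⋙ HolTHPair.forget 𝔄).map ((archIotaTS 𝔄 b ε).app x₀) : _ → _) := by
  subst hb
  revert ε
  refine fun ε => ?_
  match ν, ε with
  | _, ArchEdge.multToSpaceLink =>
    intro h
    simp only [archIotaTS, archIotaTSCore, archIotaCore, NatTrans.comp_app, eqToHom_app,
      Functor.whiskerRight_app, Functor.id_map] at h
    exact HolTFPair.forget_inclTimes_app_not_surjective 𝔄 x₀.down h

/-- **`Cor55LogWall` at the setting with genuine archimedean components, by the PRINT-FAITHFUL route** (the `TS`-side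
cycle through print's `k^× ↪ k`; second derivation of `archGenuine_cor55LogWall` for the model's own `TS`-datum,
independent of the cell's `⊞`-edge range at archimedean places). [cite: MochizukiAbsTopIII2015, Cor 5.5 (iv) p. 131] -/
theorem archGenuine_cor55LogWall_TS (𝔄 : AutHolFieldFunctor.{u}) (Vmod : Type (u + 1)) (isArc : Vmod → Bool)
    (v₀ : Vmod) (hv₀ : isArc v₀ = true) (x₀ : Up (HolTFPair 𝔄)) :
    (archGenuine 𝔄 Vmod isArc).Cor55LogWall (archGenuineTS 𝔄 Vmod isArc) :=
  (archGenuine 𝔄 Vmod isArc).cor55LogWall_of_iotaTS_spaceLink_not_surjective (archGenuineTS 𝔄 Vmod isArc) v₀ hv₀ x₀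
    (inducedFunctor _ ⋙ HolTHPair.forget 𝔄)
    (fun ν _ ε => forget_archIotaTS_spaceLink_not_surjective 𝔄 (isArc v₀) hv₀ ν ε x₀)

end LogFrobeniusSetting

end Literature.AnabelianGeometry.AbsoluteAnabelian
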